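import Mathlib.Order.Zorn
import Mathlib.Analysis.Calculus.ContDiff.FiniteDimension
import Literature.MathematicalPhysics.QuantumLattice.YangMillsHeatFlowProofs
import Literature.Geometry.Riemannian.TimeJetGluing
import HarnessLib

/-!
# Yang–Mills heat flow: continuation (Waldron 2019, Cor. 1.2 from Thm. 1.1 and short-time existence)

Sorry-free progress on the named fact
`Literature.MathematicalPhysics.QuantumLattice.Waldron2019_yangMillsFlow_flatTorus` (Waldron 2019,
Cor. 1.2 with Struwe's short-time existence), continuing `YangMillsHeatFlowProofs.lean` and
`YangMillsHeatFlowEnergy.lean`. Waldron derives Cor. 1.2 ("Assume `M⁴` is compact. Then any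
classical solution of (YM) extends smoothly for all time") from his Thm. 1.1 (at a finite time
`T` the curvature does not concentrate and "`lim_{t→T} A(t)` exists in `C^∞_loc`") in one
sentence — "Applying the short-time existence results of Struwe, we may settle the conjecture"
(p. 3), with the footnote "Uniqueness of classical solutions is folklore". The continuation
argument hidden there — restart the flow at `t = T` from the smooth limit, observe that the
concatenated solution is smooth *across* `t = T`, and pass to a maximal, hence global, solution —
is elementary but not formal-free; this file PROVES it, on flat space `E` (any finite-dimensional
real inner product space, coefficients in any real normed algebra `𝔸`) and then on the flat torus
`ℝ⁴/Lℤ⁴` in the setting of the named fact: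

* `exists_contDiff_divCurvature_eq` — the Yang–Mills vector field `div_A F_A = −D_A^* F_A` is a
  smooth (polynomial) function `Θ` of the spatial 2-jet `(A(x), DA(x), D²A(x))`
  (`fderiv_curvature_apply` is the formula for `∂F`); hence it is jointly continuous along any
  jointly smooth time-dependent connection, up to the boundary times
  (`continuousOn_divCurvature_of_contDiffOn`).
* `tD_eq_jet_of_pde` — a classical solution on `[a, b] × E` satisfies the equation in jet form
  `∂ₜu = Θ(u, ∂u, ∂²u)` with one-sided time derivatives at `t = a, b` (by continuity).
* `contDiffOn_junction_of_pde` — **junction theorem**: if `A` solves the flow on `[a, T] × E`,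
  `B` solves it on `[T, b] × E` and `A(T) = B(T)`, the concatenation is jointly `C^∞` on
  `[a, b] × E` — an instance of the general junction theorem for evolution equations
  `Literature.Geometry.Riemannian.TimeJet.contDiffOn_junction_of_pde` (all time derivatives at
  `t = T` are determined by the spatial jet through the equation; Topping 2006, p. 47, there for
  the Ricci flow).
* `restart_of_pde` — **restart**: a solution smooth on the closed slab `[0, T] × E` followed by
  a classical solution on `[0, ε) × E` from `A(T)` is a classical solution on `[0, T + ε) × E`
  (flow equation at `t = T` by continuity of both sides).
* `contDiffOn_glue`, `deriv_glue_eq` — **gluing** of families of classical solutions agreeing on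
  common time intervals (smoothness and the equation are local in time; as for the Ricci flow in
  `Literature.Geometry.Riemannian.IsRicciFlow.glue`).
* `Waldron2019_yangMillsFlow_flatTorus_of_shortTime_of_smoothExtension` — **the named fact from
  its two analytic inputs**, Struwe's short-time existence (`hST`) and Waldron's Thm. 1.1 on the
  closed flat torus in the form used for Cor. 1.2 (`hW`: a classical solution on `[0, T) × ℝ⁴`,
  `T < ∞`, is the restriction of a map jointly smooth on `[0, T] × ℝ⁴`), by Zorn's lemma on
  classical solutions preordered by extension (no uniqueness needed), `hW`, restart and the
  junction theorem. This supersedes `Waldron2019_yangMillsFlow_flatTorus_of_shortTime_of_extends`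
  (`YangMillsHeatFlowProofs.lean`), whose second hypothesis was Cor. 1.2 itself.

Small transport lemmas relate the space-time conventions `ℝ × E` (this topic) and `E × ℝ`
(`TimeJet`), slices at boundary times, and the passage of closed conditions to the final time
(`tslice_eq_at_top`, `tslice_mem_at_top`). No definition and no named fact is introduced. What
remains hypothetical are exactly the two analytic theorems: quasilinear parabolic short-time
existence with the DeTurck gauge (Struwe 1994, §4) and Waldron's Thm. 1.1 (2019, §§2–7).

References: A. Waldron, *Long-time existence for Yang–Mills flow*, Invent. Math. 217 (2019),
§1, Thm. 1.1, Cor. 1.2 and p. 3 [Waldron2019]; M. Struwe, *The Yang–Mills flow in four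
dimensions*, Calc. Var. 2 (1994), §4 [Struwe1994]; P. Topping, *Lectures on the Ricci flow*, LMS
Lecture Note Series 325 (2006), §5.3, p. 47 [Topping2006]; S. K. Donaldson, P. B. Kronheimer,
*The Geometry of Four-Manifolds* (1990), (6.2.8), §6.3.1 [DonaldsonKronheimer1990].
-/

noncomputable section

set_option maxSynthPendingDepth 3

open scoped ContDiff Topology
open Set Filter

namespace Literature.MathematicalPhysics.QuantumLattice

/-! ### The Yang–Mills vector field as a smooth function of the spatial 2-jet -/

section JetOperator

variable {E : Type*} [NormedAddCommGroup E] [InnerProductSpace ℝ E]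
variable {𝔸 : Type*} [NormedRing 𝔸] [NormedAlgebra ℝ 𝔸]

/-- Spatial derivative of the curvature components of a `C²` connection:
`∂_c F(·)(a,b) = A''(c,a,b) − A''(c,b,a) + A_a A'(c)(b) + A'(c)(a) A_b − A_b A'(c)(a) − A'(c)(b) A_a`.
[folklore] -/
theorem fderiv_curvature_apply (A : Connection E 𝔸) (hA : ContDiff ℝ 2 A) (x a b c : E) :
    fderiv ℝ (fun y => curvature A y a b) x c =
      fderiv ℝ (fderiv ℝ A) x c a b - fderiv ℝ (fderiv ℝ A) x c b a +
        (A x a * fderiv ℝ A x c b + fderiv ℝ A x c a * A x b -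
          (A x b * fderiv ℝ A x c a + fderiv ℝ A x c b * A x a)) := by
  set A' : E → E →L[ℝ] E →L[ℝ] 𝔸 := fderiv ℝ A
  set A'' : E →L[ℝ] E →L[ℝ] E →L[ℝ] 𝔸 := fderiv ℝ (fderiv ℝ A) x
  have hd : ∀ y, HasFDerivAt A (A' y) y := fun y =>
    (hA.differentiable two_ne_zero y).hasFDerivAt
  have hd' : HasFDerivAt A' A'' x :=
    ((hA.fderiv_right (m := 1) le_rfl).differentiable one_ne_zero x).hasFDerivAt
  have hc : ∀ y b, HasFDerivAt (fun z => A z b) ((A' y).flip b) y := fun y b => by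
    simpa using (hd y).clm_apply (hasFDerivAt_const b y)
  have hF : (fun y => curvature A y a b) =
      fun y => A' y a b - A' y b a + (A y a * A y b - A y b * A y a) := by
    funext y
    exact curvature_eq_of_differentiableAt A (hd y).differentiableAt a b
  have h2 : ∀ a b, HasFDerivAt (fun y => A' y a b) ((A''.flip a).flip b) x := fun a b => by
    simpa using ((hd'.clm_apply (hasFDerivAt_const a x)).clm_apply (hasFDerivAt_const b x))
  rw [hF, (((h2 a b).fun_sub (h2 b a)).fun_add
    (((hc x a).fun_mul' (hc x b)).fun_sub ((hc x b).fun_mul' (hc x a)))).fderiv]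
  simp only [add_apply, sub_apply, ContinuousLinearMap.flip_apply, smul_apply, smul_eq_mul,
    op_smul_eq_mul]

variable [FiniteDimensional ℝ E]

/-- **The Yang–Mills vector field is a smooth function of the spatial 2-jet.** There is a `C^∞`
(indeed polynomial) map `Θ` on the jet space `(E →L 𝔸) × (E →L E →L 𝔸) × (E →L E →L E →L 𝔸)`
such that `div_A F_A(x) = Θ(A(x), DA(x), D²A(x))` for every `C²` connection `A`: expanding
`∑ᵢ D_{eᵢ} F(eᵢ, ·) = ∑ᵢ (∂_{eᵢ} F(eᵢ, ·) + [A_{eᵢ}, F(eᵢ, ·)])` with `F = dA + A ∧ A`. This is the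
structural fact ("`∂ₜA` is a universal polynomial in `A, ∂A, ∂²A`") behind differentiating the
flow equation in time (Waldron 2019 (YM); Donaldson–Kronheimer (6.2.8)). [folklore] -/
theorem exists_contDiff_divCurvature_eq :
    ∃ Θ : (E →L[ℝ] 𝔸) × (E →L[ℝ] E →L[ℝ] 𝔸) × (E →L[ℝ] E →L[ℝ] E →L[ℝ] 𝔸) → E →L[ℝ] 𝔸,
      ContDiff ℝ ∞ Θ ∧ ∀ (A : Connection E 𝔸), ContDiff ℝ 2 A →
        ∀ x v, divCurvature A x v = Θ (A x, fderiv ℝ A x, fderiv ℝ (fderiv ℝ A) x) v := by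
  set e := stdOrthonormalBasis ℝ E with he
  set μ : 𝔸 →L[ℝ] 𝔸 →L[ℝ] 𝔸 := ContinuousLinearMap.mul ℝ 𝔸 with hμ
  set ev : E → (E →L[ℝ] 𝔸) →L[ℝ] 𝔸 := fun u => ContinuousLinearMap.apply ℝ 𝔸 u with hev
  -- the curvature column `v ↦ F(eᵢ, v)` as a function of the 1-jet
  set Fc : (E →L[ℝ] 𝔸) × (E →L[ℝ] E →L[ℝ] 𝔸) × (E →L[ℝ] E →L[ℝ] E →L[ℝ] 𝔸) →
      Fin (Module.finrank ℝ E) → E →L[ℝ] 𝔸 := fun q i =>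
    q.2.1 (e i) - (ev (e i)).comp q.2.1 + (μ (q.1 (e i))).comp q.1 -
      (μ.flip (q.1 (e i))).comp q.1 with hFc
  set Θ : (E →L[ℝ] 𝔸) × (E →L[ℝ] E →L[ℝ] 𝔸) × (E →L[ℝ] E →L[ℝ] E →L[ℝ] 𝔸) → E →L[ℝ] 𝔸 :=
    fun q => ∑ i, (q.2.2 (e i) (e i) - (ev (e i)).comp (q.2.2 (e i)) +
      ((μ (q.1 (e i))).comp (q.2.1 (e i)) + (μ (q.2.1 (e i) (e i))).comp q.1 -
        ((μ.flip (q.2.1 (e i) (e i))).comp q.1 + (μ.flip (q.1 (e i))).comp (q.2.1 (e i)))) +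
      ((μ (q.1 (e i))).comp (Fc q i) - (μ.flip (q.1 (e i))).comp (Fc q i))) with hΘ
  refine ⟨Θ, ?_, ?_⟩
  · have hFc' : ∀ i, ContDiff ℝ ∞ fun q => Fc q i := by
      intro i
      simp only [hFc]
      fun_prop
    simp only [hΘ]
    refine ContDiff.sum fun i _ => ?_
    have := hFc' i
    fun_prop
  · intro A hA x v
    have hdA : DifferentiableAt ℝ A x := hA.differentiable two_ne_zero x
    have hφ : ∀ i, DifferentiableAt ℝ (fun y => curvature A y (e i) v) x := fun i =>
      differentiable_curvature_apply hA (e i) v x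
    simp only [divCurvature, covDeriv, hΘ, hFc, sum_apply, add_apply, sub_apply,
      ContinuousLinearMap.comp_apply, hev, ContinuousLinearMap.apply_apply, hμ,
      ContinuousLinearMap.mul_apply', ContinuousLinearMap.flip_apply, ← he]
    refine Finset.sum_congr rfl fun i _ => ?_
    rw [fderiv_curvature_apply A hA x (e i) v (e i), curvature_eq_of_differentiableAt A hdA,
      Ring.lie_def]
    noncomm_ring

end JetOperator


/-! ### Space-time conventions and slices

This topic writes space-time as `ℝ × E` (time first) and joint maps as `fun p => A p.1 p.2`; the
junction calculus of `Literature.Geometry.Riemannian.TimeJet` writes `E × ℝ`. -/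

section Bridge

variable {E : Type*} [NormedAddCommGroup E] [InnerProductSpace ℝ E]
variable {𝔸 : Type*} [NormedRing 𝔸] [NormedAlgebra ℝ 𝔸]

/-- Joint smoothness does not depend on the order of the space and time factors. [folklore] -/
theorem contDiffOn_swap_iff {n : WithTop ℕ∞} {A : ℝ → Connection E 𝔸} {S : Set ℝ} :
    ContDiffOn ℝ n (fun q : E × ℝ => A q.2 q.1) ((univ : Set E) ×ˢ S) ↔
      ContDiffOn ℝ n (fun p : ℝ × E => A p.1 p.2) (S ×ˢ (univ : Set E)) := by
  have h1 : (fun q : E × ℝ => A q.2 q.1) =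
      (fun p : ℝ × E => A p.1 p.2) ∘ (ContinuousLinearEquiv.prodComm ℝ E ℝ) := rfl
  have h2 : (ContinuousLinearEquiv.prodComm ℝ E ℝ) ⁻¹' (S ×ˢ (univ : Set E)) =
      (univ : Set E) ×ˢ S := by
    ext ⟨y, t⟩
    simp
  rw [h1, ← h2]
  exact ContinuousLinearEquiv.contDiffOn_comp_iff _

/-- Every time slice (boundary times included) of a map jointly `C^n` on `S × E` is `C^n`.
[folklore] -/
theorem contDiff_slice_of_contDiffOn_prod {n : WithTop ℕ∞} {A : ℝ → Connection E 𝔸}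
    {S : Set ℝ} (hA : ContDiffOn ℝ n (fun p : ℝ × E => A p.1 p.2) (S ×ˢ (univ : Set E)))
    {t : ℝ} (ht : t ∈ S) : ContDiff ℝ n (A t) := by
  have : A t = (fun p : ℝ × E => A p.1 p.2) ∘ fun x : E => (t, x) := rfl
  rw [this]
  exact hA.comp_contDiff (contDiff_const.prodMk contDiff_id) fun x => ⟨ht, mem_univ x⟩

/-- Every time slice of a map jointly continuous on `S × E` is continuous in time within `S`,
at fixed `x`. [folklore] -/
theorem continuousWithinAt_tslice_of_continuousOn {A : ℝ → Connection E 𝔸} {S : Set ℝ}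
    (hA : ContinuousOn (fun p : ℝ × E => A p.1 p.2) (S ×ˢ (univ : Set E))) (x : E) {t : ℝ}
    (ht : t ∈ S) : ContinuousWithinAt (fun s => A s x) S t := by
  have h1 : ContinuousWithinAt (fun s : ℝ => ((s, x) : ℝ × E)) S t :=
    continuousWithinAt_id.prodMk continuousWithinAt_const
  exact ContinuousWithinAt.comp (f := fun s : ℝ => ((s, x) : ℝ × E)) (hA (t, x) ⟨ht, mem_univ x⟩)
    h1 fun s hs => ⟨hs, mem_univ x⟩

/-- **Closed conditions pass to the final time.** Two time slices through a jointly continuous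
map on `[a, T] × E` which agree for `t ∈ [a, T)` agree at `t = T`. [folklore] -/
theorem tslice_eq_at_top {X : Type*} [TopologicalSpace X] [T2Space X] {f g : ℝ → X} {a T : ℝ}
    (haT : a < T) (hf : ContinuousWithinAt f (Icc a T) T) (hg : ContinuousWithinAt g (Icc a T) T)
    (h : EqOn f g (Ico a T)) : f T = g T := by
  have hmem : T ∈ closure (Ico a T) := by
    rw [closure_Ico haT.ne]
    exact right_mem_Icc.2 haT.le
  haveI : (𝓝[Ico a T] T).NeBot := mem_closure_iff_nhdsWithin_neBot.1 hmem
  have hf' : Tendsto f (𝓝[Ico a T] T) (𝓝 (f T)) := hf.mono_left (nhdsWithin_mono _ Ico_subset_Icc_self)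
  have hg' : Tendsto g (𝓝[Ico a T] T) (𝓝 (g T)) := hg.mono_left (nhdsWithin_mono _ Ico_subset_Icc_self)
  exact tendsto_nhds_unique_of_eventuallyEq hf' hg' (eventually_mem_nhdsWithin.mono h)

/-- A value in a closed set for `t ∈ (a, T)` stays in it at `t = T`, along a map continuous
within `[a, T]` at `T`. [folklore] -/
theorem tslice_mem_at_top {X : Type*} [TopologicalSpace X] {f : ℝ → X} {C : Set X}
    (hC : IsClosed C) {a T : ℝ} (haT : a < T) (hf : ContinuousWithinAt f (Icc a T) T)
    (h : ∀ t ∈ Ioo a T, f t ∈ C) : f T ∈ C := by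
  have hmem : T ∈ closure (Ioo a T) := by
    rw [closure_Ioo haT.ne]
    exact right_mem_Icc.2 haT.le
  haveI : (𝓝[Ioo a T] T).NeBot := mem_closure_iff_nhdsWithin_neBot.1 hmem
  have hf' : Tendsto f (𝓝[Ioo a T] T) (𝓝 (f T)) := hf.mono_left (nhdsWithin_mono _ Ioo_subset_Icc_self)
  exact hC.mem_of_tendsto hf' (eventually_mem_nhdsWithin.mono h)

end Bridge

/-! ### Continuity of the Yang–Mills vector field along a jointly smooth family -/

section Continuity

variable {E : Type*} [NormedAddCommGroup E] [InnerProductSpace ℝ E] [FiniteDimensional ℝ E]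
variable {𝔸 : Type*} [NormedRing 𝔸] [NormedAlgebra ℝ 𝔸]

omit [FiniteDimensional ℝ E] in
/-- The spatial 1-jet `(t, x) ↦ D(A t)(x)` of a map jointly `C^∞` on `S × E` (`S` a set of unique
differentiability) is jointly `C^∞` on `S × E` (in the `E × ℝ` convention). [folklore] -/
theorem contDiffOn_fderiv_tslice {A : ℝ → Connection E 𝔸} {S : Set ℝ} (hS : UniqueDiffOn ℝ S)
    (hA : ContDiffOn ℝ ∞ (fun q : E × ℝ => A q.2 q.1) ((univ : Set E) ×ˢ S)) :
    ContDiffOn ℝ ∞ (fun q : E × ℝ => fderiv ℝ (A q.2) q.1) ((univ : Set E) ×ˢ S) :=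
  Literature.Geometry.Lorentzian.MetricCoord.contDiffOn_fderiv_slice isOpen_univ hS hA

omit [FiniteDimensional ℝ E] in
/-- The spatial 2-jet `(t, x) ↦ D²(A t)(x)` of a map jointly `C^∞` on `S × E` is jointly `C^∞`
on `S × E` (in the `E × ℝ` convention). [folklore] -/
theorem contDiffOn_fderiv_fderiv_tslice {A : ℝ → Connection E 𝔸} {S : Set ℝ}
    (hS : UniqueDiffOn ℝ S)
    (hA : ContDiffOn ℝ ∞ (fun q : E × ℝ => A q.2 q.1) ((univ : Set E) ×ˢ S)) :
    ContDiffOn ℝ ∞ (fun q : E × ℝ => fderiv ℝ (fderiv ℝ (A q.2)) q.1) ((univ : Set E) ×ˢ S) := by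
  have h := Literature.Geometry.Lorentzian.MetricCoord.contDiffOn_fderiv_slice
    (F := fun q : E × ℝ => fderiv ℝ (A q.2) q.1) isOpen_univ hS (contDiffOn_fderiv_tslice hS hA)
  exact h

/-- Along a time-dependent connection jointly `C^∞` on `S × E` (`S` a set of unique
differentiability, e.g. any non-degenerate interval), the Yang–Mills vector field
`(t, x) ↦ Σ_μ D_μ F_{μ v}(t, x)` is jointly continuous on `S × E`: it is a smooth function of the
spatial 2-jet (`exists_contDiff_divCurvature_eq`), which is jointly continuous. [folklore] -/
theorem continuousOn_divCurvature_of_contDiffOn {A : ℝ → Connection E 𝔸} {S : Set ℝ}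
    (hS : UniqueDiffOn ℝ S)
    (hA : ContDiffOn ℝ ∞ (fun p : ℝ × E => A p.1 p.2) (S ×ˢ (univ : Set E))) (v : E) :
    ContinuousOn (fun p : ℝ × E => divCurvature (A p.1) p.2 v) (S ×ˢ (univ : Set E)) := by
  obtain ⟨Θ, hΘc, hΘ⟩ := exists_contDiff_divCurvature_eq (E := E) (𝔸 := 𝔸)
  have hu : ContDiffOn ℝ ∞ (fun q : E × ℝ => A q.2 q.1) ((univ : Set E) ×ˢ S) :=
    contDiffOn_swap_iff.2 hA
  have hJ : ContDiffOn ℝ ∞ (fun q : E × ℝ =>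
      (A q.2 q.1, fderiv ℝ (A q.2) q.1, fderiv ℝ (fderiv ℝ (A q.2)) q.1)) ((univ : Set E) ×ˢ S) :=
    hu.prodMk ((contDiffOn_fderiv_tslice hS hu).prodMk (contDiffOn_fderiv_fderiv_tslice hS hu))
  have hR : ContinuousOn (fun q : E × ℝ =>
      Θ (A q.2 q.1, fderiv ℝ (A q.2) q.1, fderiv ℝ (fderiv ℝ (A q.2)) q.1) v)
      ((univ : Set E) ×ˢ S) :=
    ((ContinuousLinearMap.apply ℝ 𝔸 v).continuous.comp hΘc.continuous).comp_continuousOn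
      hJ.continuousOn
  have heq : EqOn (fun q : E × ℝ => divCurvature (A q.2) q.1 v)
      (fun q : E × ℝ => Θ (A q.2 q.1, fderiv ℝ (A q.2) q.1, fderiv ℝ (fderiv ℝ (A q.2)) q.1) v)
      ((univ : Set E) ×ˢ S) := by
    rintro ⟨y, t⟩ ⟨-, ht⟩
    have h2 : ContDiff ℝ 2 (A t) :=
      (contDiff_slice_of_contDiffOn_prod hA ht).of_le (WithTop.coe_le_coe.mpr le_top)
    exact hΘ (A t) h2 y v
  have hsw : ContinuousOn (fun q : E × ℝ => divCurvature (A q.2) q.1 v) ((univ : Set E) ×ˢ S) :=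
    hR.congr heq
  have hcomp : ContinuousOn ((fun q : E × ℝ => divCurvature (A q.2) q.1 v) ∘ Prod.swap)
      (S ×ˢ (univ : Set E)) :=
    hsw.comp continuous_swap.continuousOn fun p hp => ⟨mem_univ _, hp.1⟩
  exact hcomp

/-- In particular `t ↦ Σ_μ D_μ F_{μ v}(t, x)` is continuous on `S` at fixed `x`. [folklore] -/
theorem continuousOn_divCurvature_tslice {A : ℝ → Connection E 𝔸} {S : Set ℝ}
    (hS : UniqueDiffOn ℝ S)
    (hA : ContDiffOn ℝ ∞ (fun p : ℝ × E => A p.1 p.2) (S ×ˢ (univ : Set E))) (x v : E) :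
    ContinuousOn (fun t : ℝ => divCurvature (A t) x v) S := by
  have h1 : ContinuousOn (fun t : ℝ => ((t, x) : ℝ × E)) S :=
    continuousOn_id.prodMk continuousOn_const
  have h := (continuousOn_divCurvature_of_contDiffOn hS hA v).comp h1
    fun t ht => ⟨ht, mem_univ x⟩
  exact h

end Continuity

/-! ### The junction theorem for the Yang–Mills heat flow -/

section Junction

open Literature.Geometry.Riemannian

universe u

variable {E : Type u} [NormedAddCommGroup E] [InnerProductSpace ℝ E] [FiniteDimensional ℝ E]
variable {𝔸 : Type u} [NormedRing 𝔸] [NormedAlgebra ℝ 𝔸]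

/-- **The flow equation in jet form, up to the boundary times.** If `A` is jointly `C^∞` on
`[a, b] × E` (`a < b`) and solves `∂ₜ A_v = Σ_μ D_μ F_{μ v}` componentwise on `(a, b)`, then, in
the conventions of `TimeJet` (`u (y, t) = A t y`), the one-sided time derivative within `[a, b]`
satisfies `∂ₜ u = Θ(u, ∂_y u, ∂_y² u)` on all of `E × [a, b]` for any jet map `Θ` representing the
Yang–Mills vector field (`exists_contDiff_divCurvature_eq`): at interior times this is the
equation, at `t = a, b` both sides are continuous. [folklore] -/
theorem tD_eq_jet_of_pde
    {Θ : (E →L[ℝ] 𝔸) × (E →L[ℝ] E →L[ℝ] 𝔸) × (E →L[ℝ] E →L[ℝ] E →L[ℝ] 𝔸) → E →L[ℝ] 𝔸}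
    (hΘc : ContDiff ℝ ∞ Θ)
    (hΘ : ∀ (B : Connection E 𝔸), ContDiff ℝ 2 B →
      ∀ x v, divCurvature B x v = Θ (B x, fderiv ℝ B x, fderiv ℝ (fderiv ℝ B) x) v)
    {a b : ℝ} (hab : a < b) {A : ℝ → Connection E 𝔸}
    (hA : ContDiffOn ℝ ∞ (fun q : E × ℝ => A q.2 q.1) ((univ : Set E) ×ˢ Icc a b))
    (hpde : ∀ t ∈ Ioo a b, ∀ x v : E, deriv (fun s => A s x v) t = divCurvature (A t) x v) :
    ∀ q ∈ (univ : Set E) ×ˢ Icc a b,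
      TimeJet.tD (Icc a b) (fun q : E × ℝ => A q.2 q.1) q =
        Θ (A q.2 q.1, TimeJet.xD (fun q : E × ℝ => A q.2 q.1) q,
          TimeJet.xD
            (TimeJet.xD (fun q : E × ℝ => A q.2 q.1)) q) := by
  set u : E × ℝ → E →L[ℝ] 𝔸 := fun q => A q.2 q.1 with hu
  have hS : UniqueDiffOn ℝ (Icc a b) := uniqueDiffOn_Icc hab
  have hxD : ∀ q : E × ℝ, TimeJet.xD u q = fderiv ℝ (A q.2) q.1 :=
    fun q => rfl
  have hxD2 : ∀ q : E × ℝ, TimeJet.xD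
      (TimeJet.xD u) q = fderiv ℝ (fderiv ℝ (A q.2)) q.1 := by
    intro q
    simp only [TimeJet.xD]
    rfl
  -- both sides are continuous on `E × [a, b]`
  have hJ : ContDiffOn ℝ ∞ (fun q => (u q, TimeJet.xD u q,
      TimeJet.xD (TimeJet.xD u) q))
      ((univ : Set E) ×ˢ Icc a b) :=
    hA.prodMk ((TimeJet.contDiffOn_xD isOpen_univ hS hA).prodMk
      (TimeJet.contDiffOn_xD isOpen_univ hS
        (TimeJet.contDiffOn_xD isOpen_univ hS hA)))
  have hR : ContinuousOn (fun q => Θ (u q, TimeJet.xD u q,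
      TimeJet.xD (TimeJet.xD u) q))
      ((univ : Set E) ×ˢ Icc a b) :=
    (hΘc.continuous.comp_continuousOn hJ.continuousOn)
  have hL : ContinuousOn (TimeJet.tD (Icc a b) u)
      ((univ : Set E) ×ˢ Icc a b) :=
    (TimeJet.contDiffOn_tD isOpen_univ hS hA).continuousOn
  -- at interior times the identity is the flow equation
  have hint : EqOn (TimeJet.tD (Icc a b) u)
      (fun q => Θ (u q, TimeJet.xD u q,
        TimeJet.xD (TimeJet.xD u) q))
      ((univ : Set E) ×ˢ Ioo a b) := by
    rintro ⟨y, t⟩ ⟨-, ht⟩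
    have hq : ((y, t) : E × ℝ) ∈ (univ : Set E) ×ˢ Icc a b := ⟨mem_univ y, Ioo_subset_Icc_self ht⟩
    have hnhds : Icc a b ∈ 𝓝 t := Icc_mem_nhds ht.1 ht.2
    have hder : HasDerivAt (fun s => A s y)
        (TimeJet.tD (Icc a b) u (y, t)) t :=
      (TimeJet.hasDerivWithinAt_tD hA hq).hasDerivAt hnhds
    have h2 : ContDiff ℝ 2 (A t) :=
      (contDiff_slice_of_contDiffOn_prod (contDiffOn_swap_iff.1 hA) (Ioo_subset_Icc_self ht)).of_le
        (WithTop.coe_le_coe.mpr le_top)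
    show TimeJet.tD (Icc a b) u (y, t) =
      Θ (u (y, t), TimeJet.xD u (y, t), TimeJet.xD (TimeJet.xD u) (y, t))
    rw [hxD, hxD2]
    refine ContinuousLinearMap.ext fun v => ?_
    have hv : HasDerivAt (fun s => A s y v)
        (TimeJet.tD (Icc a b) u (y, t) v) t := by
      simpa using hder.clm_apply (hasDerivAt_const t v)
    rw [← hv.deriv, hpde t ht y v, hΘ (A t) h2 y v]
  have hcl : (univ : Set E) ×ˢ Icc a b ⊆ closure ((univ : Set E) ×ˢ Ioo a b) := by
    rw [closure_prod_eq, closure_univ, closure_Ioo hab.ne]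
  intro q hq
  exact hint.of_subset_closure hL hR (prod_mono le_rfl Ioo_subset_Icc_self) hcl hq


/-- **Smoothness across the junction of two classical solutions of the Yang–Mills heat flow**
(the "folklore" step in the passage from Waldron's Thm. 1.1 to Cor. 1.2, cf. Waldron 2019 p. 3,
footnote: restarting the flow at `t = T` from the smooth limit `A(T)` produces a solution that is
smooth *across* `t = T`). If `A` is jointly `C^∞` on `[a, T] × E` and solves
`∂ₜ A_v = Σ_μ D_μ F_{μ v}` on `(a, T)`, `B` is jointly `C^∞` on `[T, b] × E` and solves it on
`(T, b)`, and `A(T) = B(T)`, then the concatenation (`A` for `t ≤ T`, `B` after) is jointly `C^∞`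
on `[a, b] × E`. Proof: the flow equation is `∂ₜ u = Θ(u, ∂_y u, ∂_y² u)` with `Θ` smooth on the
jet space (`exists_contDiff_divCurvature_eq`, `tD_eq_jet_of_pde`), so the general junction
theorem for evolution equations `TimeJet.contDiffOn_junction_of_pde` (Topping 2006, p. 47: all
time derivatives at `t = T` are determined by the spatial jet through the equation) applies.
[cite: Waldron2019, p. 3 (proof of Cor. 1.2 from Thm. 1.1; footnote)] -/
theorem contDiffOn_junction_of_pde {a T b : ℝ} (haT : a < T) (hTb : T < b)
    {A B : ℝ → Connection E 𝔸}
    (hA : ContDiffOn ℝ ∞ (fun p : ℝ × E => A p.1 p.2) (Icc a T ×ˢ (univ : Set E)))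
    (hB : ContDiffOn ℝ ∞ (fun p : ℝ × E => B p.1 p.2) (Icc T b ×ˢ (univ : Set E)))
    (hApde : ∀ t ∈ Ioo a T, ∀ x v : E, deriv (fun s => A s x v) t = divCurvature (A t) x v)
    (hBpde : ∀ t ∈ Ioo T b, ∀ x v : E, deriv (fun s => B s x v) t = divCurvature (B t) x v)
    (h0 : A T = B T) :
    ContDiffOn ℝ ∞ (fun p : ℝ × E => (if p.1 ≤ T then A p.1 else B p.1) p.2)
      (Icc a b ×ˢ (univ : Set E)) := by
  obtain ⟨Θ, hΘc, hΘ⟩ := exists_contDiff_divCurvature_eq (E := E) (𝔸 := 𝔸)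
  set u : E × ℝ → E →L[ℝ] 𝔸 := fun q => A q.2 q.1 with hu
  set v : E × ℝ → E →L[ℝ] 𝔸 := fun q => B q.2 q.1 with hv
  have hu' : ContDiffOn ℝ ∞ u ((univ : Set E) ×ˢ Icc a T) := contDiffOn_swap_iff.2 hA
  have hv' : ContDiffOn ℝ ∞ v ((univ : Set E) ×ˢ Icc T b) := contDiffOn_swap_iff.2 hB
  set Θ' : E × (E →L[ℝ] 𝔸) × (E →L[ℝ] E →L[ℝ] 𝔸) × (E →L[ℝ] E →L[ℝ] E →L[ℝ] 𝔸) → E →L[ℝ] 𝔸 :=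
    fun J => Θ J.2 with hΘ'
  have hΘ'c : ContDiffOn ℝ ∞ Θ' univ := (hΘc.comp contDiff_snd).contDiffOn
  have hpde₁ := tD_eq_jet_of_pde hΘc hΘ haT hu' hApde
  have hpde₂ := tD_eq_jet_of_pde hΘc hΘ hTb hv' hBpde
  have hslice : TimeJet.SliceEq univ T u v := by
    intro y _
    simp only [hu, hv, h0]
  have key := TimeJet.contDiffOn_junction_of_pde (u := u) (v := v)
    isOpen_univ haT hTb (O := univ) isOpen_univ hΘ'c hu' hv' (mapsTo_univ _ _) (mapsTo_univ _ _)
    (fun q hq => hpde₁ q hq) (fun q hq => hpde₂ q hq) hslice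
  have heq : (fun q : E × ℝ => if q.2 ≤ T then u q else v q) =
      fun q : E × ℝ => (fun t => if t ≤ T then A t else B t) q.2 q.1 := by
    funext q
    simp only [hu, hv]
    split_ifs <;> rfl
  rw [heq] at key
  exact (contDiffOn_swap_iff (A := fun t => if t ≤ T then A t else B t) (S := Icc a b)).1 key

end Junction


/-! ### Time derivatives of slices on open time sets -/

section SliceDeriv

variable {E : Type*} [NormedAddCommGroup E] [InnerProductSpace ℝ E]
variable {𝔸 : Type*} [NormedRing 𝔸] [NormedAlgebra ℝ 𝔸]

/-- For a map jointly `C^n`, `n ≠ 0`, on `U × E` with `U` open, the partial time derivative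
`t ↦ ∂ₜ A_v(t, x)` is continuous on `U`. [folklore] -/
theorem continuousOn_deriv_tslice_of_contDiffOn {n : WithTop ℕ∞} {A : ℝ → Connection E 𝔸}
    {U : Set ℝ} (hU : IsOpen U)
    (hA : ContDiffOn ℝ n (fun p : ℝ × E => A p.1 p.2) (U ×ˢ (univ : Set E))) (hn : n ≠ 0)
    (x v : E) : ContinuousOn (fun t => deriv (fun s => A s x v) t) U := by
  have hO : IsOpen (U ×ˢ (univ : Set E)) := hU.prod isOpen_univ
  have hF : ContinuousOn (fun p : ℝ × E => fderiv ℝ (fun q : ℝ × E => A q.1 q.2) p)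
      (U ×ˢ (univ : Set E)) :=
    hA.continuousOn_fderiv_of_isOpen hO (ENat.one_le_iff_ne_zero_withTop.mpr hn)
  have h1 : ContinuousOn (fun t : ℝ => ((t, x) : ℝ × E)) U :=
    continuousOn_id.prodMk continuousOn_const
  have hG : ContinuousOn (fun t : ℝ => fderiv ℝ (fun q : ℝ × E => A q.1 q.2) (t, x)) U :=
    hF.comp h1 fun t ht => ⟨ht, mem_univ x⟩
  have hH : ContinuousOn
      (fun t : ℝ => fderiv ℝ (fun q : ℝ × E => A q.1 q.2) (t, x) ((1 : ℝ), (0 : E)) v) U :=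
    ((ContinuousLinearMap.apply ℝ 𝔸 v).continuous.comp
      (ContinuousLinearMap.apply ℝ (E →L[ℝ] 𝔸) ((1 : ℝ), (0 : E))).continuous).comp_continuousOn hG
  refine hH.congr fun t ht => ?_
  exact (hasDerivAt_slice_apply hO hA hn ⟨ht, mem_univ x⟩ v).deriv

end SliceDeriv

/-! ### Restarting the flow: the concatenated solution -/

section Restart

open Literature.Geometry.Riemannian

universe u

variable {E : Type u} [NormedAddCommGroup E] [InnerProductSpace ℝ E] [FiniteDimensional ℝ E]
variable {𝔸 : Type u} [NormedRing 𝔸] [NormedAlgebra ℝ 𝔸]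

/-- **Restart.** Let `A` be jointly `C^∞` on `[0, T] × E` (`T > 0`) and solve the Yang–Mills heat
flow `∂ₜ A_v = Σ_μ D_μ F_{μ v}` on `(0, T)`, and let `B` be a classical solution on `[0, ε) × E`
(jointly `C^∞` on `[0, ε) × E`, solving the flow on `(0, ε)`) with initial value `B(0) = A(T)`.
Then the concatenation `C(t) = A(t)` for `t ≤ T`, `C(t) = B(t − T)` for `t > T`, is a classical
solution on `[0, T + ε) × E`: jointly `C^∞` (the junction theorem `contDiffOn_junction_of_pde`
on `[0, T] ∪ [T, T + ε']` for every `ε' < ε`) and solving the flow on `(0, T + ε)` — at `t = T`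
because both `∂ₜ C` and `div_C F_C` are continuous there. This is the restart step in the proof
of Waldron's Cor. 1.2 from Thm. 1.1 ("Applying the short-time existence results of Struwe …",
Waldron 2019, p. 3). [cite: Waldron2019, p. 3 (proof of Cor. 1.2)] -/
theorem restart_of_pde {T ε : ℝ} (hT : 0 < T) (hε : 0 < ε) {A B : ℝ → Connection E 𝔸}
    (hA : ContDiffOn ℝ ∞ (fun p : ℝ × E => A p.1 p.2) (Icc 0 T ×ˢ (univ : Set E)))
    (hApde : ∀ t ∈ Ioo 0 T, ∀ x v : E, deriv (fun s => A s x v) t = divCurvature (A t) x v)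
    (hB : ContDiffOn ℝ ∞ (fun p : ℝ × E => B p.1 p.2) (Ico 0 ε ×ˢ (univ : Set E)))
    (hBpde : ∀ t ∈ Ioo 0 ε, ∀ x v : E, deriv (fun s => B s x v) t = divCurvature (B t) x v)
    (h0 : B 0 = A T) :
    ContDiffOn ℝ ∞ (fun p : ℝ × E => (if p.1 ≤ T then A p.1 else B (p.1 - T)) p.2)
        (Ico 0 (T + ε) ×ˢ (univ : Set E)) ∧
      ∀ t ∈ Ioo 0 (T + ε), ∀ x v : E,
        deriv (fun s => (if s ≤ T then A s else B (s - T)) x v) t =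
          divCurvature (if t ≤ T then A t else B (t - T)) x v := by
  set C : ℝ → Connection E 𝔸 := fun t => if t ≤ T then A t else B (t - T) with hC
  -- the shifted second piece
  set B' : ℝ → Connection E 𝔸 := fun t => B (t - T) with hB'
  have hB's : ∀ {ε' : ℝ}, ε' < ε →
      ContDiffOn ℝ ∞ (fun p : ℝ × E => B' p.1 p.2) (Icc T (T + ε') ×ˢ (univ : Set E)) := by
    intro ε' hε'
    have hsh : ContDiff ℝ ∞ (fun p : ℝ × E => ((p.1 - T, p.2) : ℝ × E)) :=
      (contDiff_fst.sub contDiff_const).prodMk contDiff_snd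
    refine (hB.comp hsh.contDiffOn ?_)
    rintro ⟨t, y⟩ ⟨ht, -⟩
    exact ⟨⟨by linarith [ht.1], by linarith [ht.2]⟩, mem_univ _⟩
  have hB'pde : ∀ t ∈ Ioo T (T + ε), ∀ x v : E,
      deriv (fun s => B' s x v) t = divCurvature (B' t) x v := by
    intro t ht x v
    simp only [hB']
    rw [deriv_comp_sub_const (f := fun s => B s x v)]
    exact hBpde (t - T) ⟨by linarith [ht.1], by linarith [ht.2]⟩ x v
  have h0' : A T = B' T := by simp [hB', h0]
  -- joint smoothness on `[0, T + ε'] × E` for every `ε' < ε`, by the junction theorem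
  have hjunc : ∀ {ε' : ℝ}, 0 < ε' → ε' < ε →
      ContDiffOn ℝ ∞ (fun p : ℝ × E => C p.1 p.2) (Icc 0 (T + ε') ×ˢ (univ : Set E)) := by
    intro ε' hε'0 hε'
    have h := contDiffOn_junction_of_pde (A := A) (B := B') hT (by linarith) hA (hB's hε') hApde
      (fun t ht x v => hB'pde t ⟨ht.1, by linarith [ht.2]⟩ x v) h0'
    exact h
  -- hence on `[0, T + ε) × E`
  have hsmooth : ContDiffOn ℝ ∞ (fun p : ℝ × E => C p.1 p.2) (Ico 0 (T + ε) ×ˢ (univ : Set E)) := by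
    rintro ⟨t, y⟩ ⟨ht, -⟩
    -- an `ε'` with `max (t - T) 0 < ε' < ε`
    set ε' : ℝ := (max (t - T) 0 + ε) / 2 with hε'
    have hmax : max (t - T) 0 < ε := max_lt (by linarith [ht.2]) hε
    have hε'0 : 0 < ε' := by
      have := le_max_right (t - T) 0
      rw [hε']; linarith
    have hε'ε : ε' < ε := by rw [hε']; linarith
    have htε' : t < T + ε' := by
      have := le_max_left (t - T) 0
      rw [hε']; linarith
    have hW : ContDiffWithinAt ℝ ∞ (fun p : ℝ × E => C p.1 p.2) (Icc 0 (T + ε') ×ˢ (univ : Set E))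
        (t, y) := hjunc hε'0 hε'ε (t, y) ⟨⟨ht.1, htε'.le⟩, mem_univ y⟩
    refine hW.mono_of_mem_nhdsWithin ?_
    refine mem_nhdsWithin.2 ⟨Iio (T + ε') ×ˢ (univ : Set E), isOpen_Iio.prod isOpen_univ,
      ⟨htε', mem_univ y⟩, ?_⟩
    rintro ⟨s, z⟩ ⟨⟨hs1, -⟩, ⟨hs2, -⟩⟩
    exact ⟨⟨hs2.1, le_of_lt hs1⟩, mem_univ z⟩
  refine ⟨hsmooth, ?_⟩
  -- the flow equation on `(0, T + ε)`
  have hO : IsOpen (Ioo 0 (T + ε)) := isOpen_Ioo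
  have hsmooth' : ContDiffOn ℝ ∞ (fun p : ℝ × E => C p.1 p.2) (Ioo 0 (T + ε) ×ˢ (univ : Set E)) :=
    hsmooth.mono (prod_mono Ioo_subset_Ico_self le_rfl)
  intro t ht x v
  rcases lt_trichotomy t T with hlt | rfl | hgt
  · -- before the junction the concatenation is `A`
    have hev : (fun s => C s x v) =ᶠ[𝓝 t] fun s => A s x v := by
      filter_upwards [Iio_mem_nhds hlt] with s hs
      have hs' : s ≤ T := le_of_lt hs
      simp [hC, hs']
    rw [hev.deriv_eq, hApde t ⟨ht.1, hlt⟩ x v]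
    simp [hlt.le]
  · -- at the junction both sides are continuous in time and agree for `t < T`
    have hd : ContinuousOn (fun s => deriv (fun s' => C s' x v) s) (Ioo 0 (t + ε)) :=
      continuousOn_deriv_tslice_of_contDiffOn hO hsmooth' (by simp) x v
    have hr : ContinuousOn (fun s => divCurvature (C s) x v) (Ioo 0 (t + ε)) :=
      continuousOn_divCurvature_tslice (uniqueDiffOn_Ioo 0 (t + ε)) hsmooth' x v
    have hsub : Icc (t / 2) t ⊆ Ioo 0 (t + ε) := fun s hs => ⟨by linarith [hs.1], by linarith [hs.2]⟩
    have heq : EqOn (fun s => deriv (fun s' => C s' x v) s) (fun s => divCurvature (C s) x v)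
        (Ico (t / 2) t) := by
      intro s hs
      have hev : (fun s' => C s' x v) =ᶠ[𝓝 s] fun s' => A s' x v := by
        filter_upwards [Iio_mem_nhds hs.2] with s' hs'
        have hs'' : s' ≤ t := le_of_lt hs'
        simp [hC, hs'']
      show deriv (fun s' => C s' x v) s = divCurvature (C s) x v
      rw [hev.deriv_eq, hApde s ⟨by linarith [hs.1], hs.2⟩ x v]
      simp [hC, hs.2.le]
    have key := tslice_eq_at_top (f := fun s => deriv (fun s' => C s' x v) s)
      (g := fun s => divCurvature (C s) x v) (half_lt_self ht.1)
      ((hd.mono hsub).continuousWithinAt ⟨(half_lt_self ht.1).le, le_rfl⟩)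
      ((hr.mono hsub).continuousWithinAt ⟨(half_lt_self ht.1).le, le_rfl⟩) heq
    simpa [hC] using key
  · -- after the junction the concatenation is the shifted restart
    have hev : (fun s => C s x v) =ᶠ[𝓝 t] fun s => B' s x v := by
      filter_upwards [Ioi_mem_nhds hgt] with s hs
      have hs' : ¬ s ≤ T := not_le.2 (mem_Ioi.1 hs)
      simp [hC, hB', hs']
    rw [hev.deriv_eq, hB'pde t ⟨hgt, ht.2⟩ x v]
    simp [hB', not_le.2 hgt]

end Restart

/-! ### Gluing a chain of solutions -/

section Glue

variable {E : Type*} [NormedAddCommGroup E] [InnerProductSpace ℝ E] [FiniteDimensional ℝ E]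
variable {𝔸 : Type*} [NormedRing 𝔸] [NormedAlgebra ℝ 𝔸]

omit [FiniteDimensional ℝ E] in
/-- **Gluing solutions which agree on common intervals.** Let `G i` be jointly `C^∞` on
`[0, Tᵢ) × E`, pairwise equal on the common intervals `[0, min Tᵢ Tⱼ)`, and let `σ` select for each
time `t ∈ S ⊆ [0, ∞)` an index with `t < T_{σ t}`. Then the glued map `(t, x) ↦ G (σ t) t x` is
jointly `C^∞` on `S × E`: near each `t` it *is* the single map `G (σ t)`, and smoothness is local.
(As for the Ricci flow, `Literature.Geometry.Riemannian.IsRicciFlow.glue`.) [folklore] -/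
theorem contDiffOn_glue {ι : Type*} {T : ι → ℝ} {G : ι → ℝ → Connection E 𝔸}
    (hsmooth : ∀ i, ContDiffOn ℝ ∞ (fun p : ℝ × E => G i p.1 p.2) (Ico 0 (T i) ×ˢ (univ : Set E)))
    (hagree : ∀ i j, ∀ s ∈ Ico 0 (min (T i) (T j)), G i s = G j s)
    {S : Set ℝ} (hS : S ⊆ Ici 0) (σ : ℝ → ι) (hlt : ∀ t ∈ S, t < T (σ t)) :
    ContDiffOn ℝ ∞ (fun p : ℝ × E => G (σ p.1) p.1 p.2) (S ×ˢ (univ : Set E)) := by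
  have key : ∀ t ∈ S, ∀ s ∈ S, s < T (σ t) → G (σ s) s = G (σ t) s := fun t _ s hs hst =>
    hagree (σ s) (σ t) s ⟨hS hs, lt_min (hlt s hs) hst⟩
  rintro ⟨t, x⟩ ⟨ht, -⟩
  have hA : ContDiffWithinAt ℝ ∞ (fun p : ℝ × E => G (σ t) p.1 p.2)
      ((S ∩ Iio (T (σ t))) ×ˢ (univ : Set E)) (t, x) :=
    (hsmooth (σ t) (t, x) ⟨⟨hS ht, hlt t ht⟩, mem_univ x⟩).mono
      (prod_mono (fun s hs => ⟨hS hs.1, hs.2⟩) le_rfl)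
  have hB : ContDiffWithinAt ℝ ∞ (fun p : ℝ × E => G (σ p.1) p.1 p.2)
      ((S ∩ Iio (T (σ t))) ×ˢ (univ : Set E)) (t, x) := by
    refine hA.congr (fun q hq => ?_) (by rfl)
    obtain ⟨⟨hqS, hqlt⟩, -⟩ := hq
    simp only [key t ht q.1 hqS hqlt]
  refine hB.mono_of_mem_nhdsWithin ?_
  refine mem_nhdsWithin.2 ⟨Iio (T (σ t)) ×ˢ (univ : Set E), isOpen_Iio.prod isOpen_univ,
    ⟨hlt t ht, mem_univ x⟩, ?_⟩
  rintro ⟨s, y⟩ ⟨⟨hs1, -⟩, ⟨hs2, -⟩⟩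
  exact ⟨⟨hs2, hs1⟩, mem_univ y⟩

/-- **The glued family solves the flow** wherever the pieces do: at every `t ∈ S`, `t > 0`, with
`S` a neighbourhood of `t`, `∂ₜ` of the glued family is `∂ₜ` of the single solution `G (σ t)`
(the flow equation is local in time). [folklore] -/
theorem deriv_glue_eq {ι : Type*} {T : ι → ℝ} {G : ι → ℝ → Connection E 𝔸}
    (hpde : ∀ i, ∀ t ∈ Ioo 0 (T i), ∀ x v : E,
      deriv (fun s => G i s x v) t = divCurvature (G i t) x v)
    (hagree : ∀ i j, ∀ s ∈ Ico 0 (min (T i) (T j)), G i s = G j s)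
    {S : Set ℝ} (hS : S ⊆ Ici 0) (σ : ℝ → ι) (hlt : ∀ t ∈ S, t < T (σ t))
    {t : ℝ} (ht : t ∈ S) (ht0 : 0 < t) (hSt : S ∈ 𝓝 t) (x v : E) :
    deriv (fun s => G (σ s) s x v) t = divCurvature (G (σ t) t) x v := by
  have key : ∀ s ∈ S, s < T (σ t) → G (σ s) s = G (σ t) s := fun s hs hst =>
    hagree (σ s) (σ t) s ⟨hS hs, lt_min (hlt s hs) hst⟩
  have hev : (fun s => G (σ s) s x v) =ᶠ[𝓝 t] fun s => G (σ t) s x v := by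
    filter_upwards [hSt, Iio_mem_nhds (hlt t ht)] with s hs hs'
    rw [key s hs hs']
  rw [hev.deriv_eq]
  exact hpde (σ t) t ⟨ht0, hlt t ht⟩ x v

end Glue

/-! ### Global existence on the flat torus from short-time existence and Waldron's Thm. 1.1 -/

section Torus

open scoped Matrix.Norms.Frobenius

/-- **`Waldron2019_yangMillsFlow_flatTorus` from Struwe's short-time existence and Waldron's
Thm. 1.1, with the continuation argument PROVED.** The two analytic inputs, stated for the
trivial `U(N)`-bundle over the flat torus `ℝ⁴/Lℤ⁴` as `L`-periodic classical solutions on `ℝ⁴`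
(tree conventions `∂ₜ A_v = Σ_μ D_μ F_{μ v} = −(D_A^* F_A)_v`), are taken as hypotheses:
* `hST` — **short-time existence** (Struwe 1994, the local existence theorem invoked by Waldron
  before Cor. 1.2): every smooth `L`-periodic `𝔲(N)`-valued `A₀` launches a classical solution,
  jointly smooth on `[0, ε) × ℝ⁴` for some `ε > 0`, periodic, `𝔲(N)`-valued, solving the flow on
  `(0, ε)`;
* `hW` — **Waldron 2019, Thm. 1.1, on a closed manifold** ("`lim_{t → T} A(t)` exists in
  `C^∞`"; hypothesis (1.1) there "is immediate from the global energy identity" over a closed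
  manifold, Waldron p. 3, cf. `YangMillsHeatFlowEnergy.lean`), in the form in which it enters
  the proof of Cor. 1.2: every classical solution on `[0, T) × ℝ⁴`, `0 < T < ∞`, is the
  restriction of a map jointly smooth on the closed slab `[0, T] × ℝ⁴`.
From these, Waldron's Cor. 1.2 — global smooth solutions — follows by the continuation argument
proved in this file: classical solutions from `A₀` on half-open slabs `[0, T)` are preordered by
extension; chains glue (`contDiffOn_glue`, `deriv_glue_eq`); if no global solution existed,
every chain would be bounded and Zorn's lemma would give a maximal solution on some `[0, T)`,
which `hW` extends smoothly to `[0, T]` (periodicity and `𝔲(N)`-values pass to `t = T` by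
continuity), `hST` restarts at `A(T)`, and `restart_of_pde` (the junction theorem) produces a
strictly longer classical solution — a contradiction. Uniqueness of classical solutions
("folklore", Waldron p. 3, footnote) is not needed for this. The passage to the flow-line record
is `Waldron2019_yangMillsFlow_flatTorus_of_pde`.
[cite: Waldron2019, Thm. 1.1, Cor. 1.2 and p. 3] [cite: Struwe1994, §4 (local existence)] -/
theorem Waldron2019_yangMillsFlow_flatTorus_of_shortTime_of_smoothExtension
    (hST : ∀ (N : ℕ) (L : ℝ), 0 < L →
      ∀ A₀ : Connection (EuclideanSpace ℝ (Fin 4)) (Matrix (Fin N) (Fin N) ℂ),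
        IsSmoothConnection A₀ →
        A₀.IsValuedIn (skewAdjoint.submodule ℝ (Matrix (Fin N) (Fin N) ℂ)) →
        A₀.IsLatticePeriodic L →
        ∃ ε : ℝ, 0 < ε ∧
          ∃ A : ℝ → Connection (EuclideanSpace ℝ (Fin 4)) (Matrix (Fin N) (Fin N) ℂ),
            A 0 = A₀ ∧
            ContDiffOn ℝ ∞ (fun p : ℝ × EuclideanSpace ℝ (Fin 4) => A p.1 p.2)
              (Ico 0 ε ×ˢ univ) ∧
            (∀ t : ℝ, 0 ≤ t → t < ε → (A t).IsLatticePeriodic L) ∧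
            (∀ t : ℝ, 0 < t → t < ε →
              (A t).IsValuedIn (skewAdjoint.submodule ℝ (Matrix (Fin N) (Fin N) ℂ))) ∧
            ∀ t : ℝ, 0 < t → t < ε → ∀ x v : EuclideanSpace ℝ (Fin 4),
              deriv (fun s => A s x v) t = divCurvature (A t) x v)
    (hW : ∀ (N : ℕ) (L : ℝ), 0 < L → ∀ T : ℝ, 0 < T →
      ∀ B : ℝ → Connection (EuclideanSpace ℝ (Fin 4)) (Matrix (Fin N) (Fin N) ℂ),
        ContDiffOn ℝ ∞ (fun p : ℝ × EuclideanSpace ℝ (Fin 4) => B p.1 p.2) (Ico 0 T ×ˢ univ) →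
        (∀ t : ℝ, 0 ≤ t → t < T → (B t).IsLatticePeriodic L) →
        (∀ t : ℝ, 0 < t → t < T →
          (B t).IsValuedIn (skewAdjoint.submodule ℝ (Matrix (Fin N) (Fin N) ℂ))) →
        (∀ t : ℝ, 0 < t → t < T → ∀ x v : EuclideanSpace ℝ (Fin 4),
          deriv (fun s => B s x v) t = divCurvature (B t) x v) →
        ∃ B' : ℝ → Connection (EuclideanSpace ℝ (Fin 4)) (Matrix (Fin N) (Fin N) ℂ),
          (∀ t : ℝ, 0 ≤ t → t < T → B' t = B t) ∧
          ContDiffOn ℝ ∞ (fun p : ℝ × EuclideanSpace ℝ (Fin 4) => B' p.1 p.2)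
            (Icc 0 T ×ˢ univ)) :
    Waldron2019_yangMillsFlow_flatTorus := by
  refine Waldron2019_yangMillsFlow_flatTorus_of_pde fun N L hL A₀ hs hv hp => ?_
  -- notation
  let X := EuclideanSpace ℝ (Fin 4)
  let 𝔤 : Submodule ℝ (Matrix (Fin N) (Fin N) ℂ) := skewAdjoint.submodule ℝ (Matrix (Fin N) (Fin N) ℂ)
  have h𝔤 : IsClosed (𝔤 : Set (Matrix (Fin N) (Fin N) ℂ)) := 𝔤.closed_of_finiteDimensional
  by_contra hglob
  -- partial classical solutions from `A₀` on `[0, T)`, `T > 0`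
  let P : ℝ × (ℝ → Connection X (Matrix (Fin N) (Fin N) ℂ)) → Prop := fun p =>
    0 < p.1 ∧ p.2 0 = A₀ ∧
      ContDiffOn ℝ ∞ (fun q : ℝ × X => p.2 q.1 q.2) (Ico 0 p.1 ×ˢ univ) ∧
      (∀ t : ℝ, 0 ≤ t → t < p.1 → (p.2 t).IsLatticePeriodic L) ∧
      (∀ t : ℝ, 0 < t → t < p.1 → (p.2 t).IsValuedIn 𝔤) ∧
      ∀ t : ℝ, 0 < t → t < p.1 → ∀ x v : X, deriv (fun s => p.2 s x v) t = divCurvature (p.2 t) x v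
  -- preordered by extension
  let r : {p // P p} → {p // P p} → Prop := fun p q =>
    p.1.1 ≤ q.1.1 ∧ ∀ t ∈ Ico 0 p.1.1, q.1.2 t = p.1.2 t
  -- nonempty by short-time existence
  obtain ⟨ε₀, hε₀, Aε, hAε0, hAεs, hAεp, hAεv, hAεpde⟩ := hST N L hL A₀ hs hv hp
  have pε : P (ε₀, Aε) := ⟨hε₀, hAε0, hAεs, hAεp, hAεv, hAεpde⟩
  haveI : Nonempty {p // P p} := ⟨⟨_, pε⟩⟩
  have htrans : ∀ {a b c : {p // P p}}, r a b → r b c → r a c := by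
    rintro a b c ⟨hab, hab'⟩ ⟨hbc, hbc'⟩
    exact ⟨hab.trans hbc, fun t ht => (hbc' t ⟨ht.1, ht.2.trans_le hab⟩).trans (hab' t ht)⟩
  -- every nonempty chain has an upper bound (or produces a global solution)
  have hchain : ∀ c : Set {p // P p}, IsChain r c → c.Nonempty → ∃ ub, ∀ a ∈ c, r a ub := by
    intro c hc ⟨p₀, hp₀⟩
    have hagree : ∀ a b : c, ∀ s ∈ Ico 0 (min a.1.1.1 b.1.1.1), a.1.1.2 s = b.1.1.2 s := by
      intro a b s hs
      by_cases hab : a.1 = b.1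
      · rw [hab]
      rcases hc a.2 b.2 hab with h | h
      · exact (h.2 s ⟨hs.1, hs.2.trans_le (min_le_left _ _)⟩).symm
      · exact h.2 s ⟨hs.1, hs.2.trans_le (min_le_right _ _)⟩
    have hsm : ∀ a : c, ContDiffOn ℝ ∞ (fun q : ℝ × X => a.1.1.2 q.1 q.2)
        (Ico 0 a.1.1.1 ×ˢ univ) := fun a => a.1.2.2.2.1
    have hpd : ∀ a : c, ∀ t ∈ Ioo 0 a.1.1.1, ∀ x v : X,
        deriv (fun s => a.1.1.2 s x v) t = divCurvature (a.1.1.2 t) x v :=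
      fun a t ht x v => a.1.2.2.2.2.2.2 t ht.1 ht.2 x v
    -- a time selector
    have hsel : ∀ t : ℝ, ∃ a : c, (∃ b : c, t < b.1.1.1) → t < a.1.1.1 := by
      intro t
      by_cases h : ∃ b : c, t < b.1.1.1
      · obtain ⟨b, hb⟩ := h
        exact ⟨b, fun _ => hb⟩
      · exact ⟨⟨p₀, hp₀⟩, fun h' => (h h').elim⟩
    choose σ hσ using hsel
    by_cases hbdd : BddAbove (range fun a : c => a.1.1.1)
    · -- bounded chain: glue on `[0, T*)`
      haveI : Nonempty c := ⟨⟨p₀, hp₀⟩⟩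
      have hle : ∀ a : c, a.1.1.1 ≤ ⨆ b : c, b.1.1.1 := fun a => le_ciSup hbdd a
      have hpos : 0 < ⨆ b : c, b.1.1.1 := p₀.2.1.trans_le (hle ⟨p₀, hp₀⟩)
      have hlt : ∀ t ∈ Ico 0 (⨆ b : c, b.1.1.1), t < (σ t).1.1.1 := fun t ht =>
        hσ t (exists_lt_of_lt_ciSup ht.2)
      have hG := contDiffOn_glue (T := fun a : c => a.1.1.1) (G := fun a : c => a.1.1.2) hsm hagree
        (S := Ico 0 (⨆ b : c, b.1.1.1)) (fun t ht => ht.1) σ hlt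
      have hD : ∀ t : ℝ, 0 < t → t < (⨆ b : c, b.1.1.1) → ∀ x v : X,
          deriv (fun s => (σ s).1.1.2 s x v) t = divCurvature ((σ t).1.1.2 t) x v :=
        fun t ht0 ht x v => deriv_glue_eq (T := fun a : c => a.1.1.1) (G := fun a : c => a.1.1.2)
          hpd hagree (S := Ico 0 (⨆ b : c, b.1.1.1)) (fun t ht => ht.1) σ hlt ⟨ht0.le, ht⟩ ht0
          (Ico_mem_nhds ht0 ht) x v
      have h0 : (σ 0).1.1.2 0 = A₀ := (σ 0).1.2.2.1
      have Pub : P (⨆ b : c, b.1.1.1, fun t => (σ t).1.1.2 t) :=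
        ⟨hpos, h0, hG, fun t ht0 ht => (σ t).1.2.2.2.2.1 t ht0 (hlt t ⟨ht0, ht⟩),
          fun t ht0 ht => (σ t).1.2.2.2.2.2.1 t ht0 (hlt t ⟨ht0.le, ht⟩), hD⟩
      refine ⟨⟨_, Pub⟩, fun a ha => ⟨hle ⟨a, ha⟩, fun t ht => ?_⟩⟩
      have ht' : t ∈ Ico 0 (⨆ b : c, b.1.1.1) := ⟨ht.1, ht.2.trans_le (hle ⟨a, ha⟩)⟩
      exact hagree (σ t) ⟨a, ha⟩ t ⟨ht.1, lt_min (hlt t ht') ht.2⟩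
    · -- unbounded chain: the glued solution is global, excluded by `hglob`
      exfalso
      have hex : ∀ t : ℝ, ∃ b : c, t < b.1.1.1 := fun t => by
        obtain ⟨_, ⟨b, rfl⟩, hb⟩ := not_bddAbove_iff.1 hbdd t
        exact ⟨b, hb⟩
      have hlt : ∀ t ∈ Ici (0 : ℝ), t < (σ t).1.1.1 := fun t _ => hσ t (hex t)
      have hG := contDiffOn_glue (T := fun a : c => a.1.1.1) (G := fun a : c => a.1.1.2) hsm hagree
        (S := Ici 0) (fun t ht => ht) σ hlt
      have hD : ∀ t : ℝ, 0 < t → ∀ x v : X,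
          deriv (fun s => (σ s).1.1.2 s x v) t = divCurvature ((σ t).1.1.2 t) x v :=
        fun t ht0 x v => deriv_glue_eq (T := fun a : c => a.1.1.1) (G := fun a : c => a.1.1.2)
          hpd hagree (S := Ici 0) (fun t ht => ht) σ hlt ht0.le ht0 (Ici_mem_nhds ht0) x v
      exact hglob ⟨fun t => (σ t).1.1.2 t, (σ 0).1.2.2.1, hG,
        fun t ht0 => (σ t).1.2.2.2.2.1 t ht0 (hlt t ht0),
        fun t ht0 => (σ t).1.2.2.2.2.2.1 t ht0 (hlt t ht0.le), hD⟩
  -- a maximal partial solution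
  obtain ⟨m, hm⟩ := exists_maximal_of_nonempty_chains_bounded hchain htrans
  obtain ⟨⟨T, A⟩, hT, hA0, hAs, hAp, hAv, hApde⟩ := m
  dsimp only at hT hA0 hAs hAp hAv hApde
  -- Waldron's Thm. 1.1: smooth extension to the closed slab `[0, T] × ℝ⁴`
  obtain ⟨Ā, hĀA, hĀs⟩ := hW N L hL T hT A hAs hAp hAv hApde
  have hĀc : ContinuousOn (fun p : ℝ × X => Ā p.1 p.2) (Icc 0 T ×ˢ univ) := hĀs.continuousOn
  have hĀper : ∀ t : ℝ, 0 ≤ t → t ≤ T → (Ā t).IsLatticePeriodic L := by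
    intro t ht0 htT
    rcases lt_or_eq_of_le htT with hlt | rfl
    · rw [hĀA t ht0 hlt]
      exact hAp t ht0 hlt
    · intro x i
      have key := tslice_eq_at_top (f := fun s => Ā s (x + EuclideanSpace.single i L))
        (g := fun s => Ā s x) hT
        ((continuousWithinAt_tslice_of_continuousOn hĀc _ ⟨ht0, le_rfl⟩))
        ((continuousWithinAt_tslice_of_continuousOn hĀc _ ⟨ht0, le_rfl⟩))
        (fun s hs => by
          show Ā s (x + EuclideanSpace.single i L) = Ā s x
          rw [hĀA s hs.1 hs.2]
          exact hAp s hs.1 hs.2 x i)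
      exact key
  have hĀval : ∀ t : ℝ, 0 < t → t ≤ T → (Ā t).IsValuedIn 𝔤 := by
    intro t ht0 htT
    rcases lt_or_eq_of_le htT with hlt | rfl
    · rw [hĀA t ht0.le hlt]
      exact hAv t ht0 hlt
    · intro x v
      have hcw : ContinuousWithinAt (fun s => Ā s x v) (Icc 0 t) t :=
        ((ContinuousLinearMap.apply ℝ (Matrix (Fin N) (Fin N) ℂ) v).continuous.continuousAt).comp_continuousWithinAt
          (continuousWithinAt_tslice_of_continuousOn hĀc x ⟨ht0.le, le_rfl⟩)
      refine tslice_mem_at_top (f := fun s => Ā s x v) h𝔤 hT hcw fun s hs => ?_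
      show Ā s x v ∈ 𝔤
      rw [hĀA s hs.1.le hs.2]
      exact hAv s hs.1 hs.2 x v
  have hĀpde : ∀ t ∈ Ioo 0 T, ∀ x v : X, deriv (fun s => Ā s x v) t = divCurvature (Ā t) x v := by
    intro t ht x v
    have hev : (fun s => Ā s x v) =ᶠ[𝓝 t] fun s => A s x v := by
      filter_upwards [Ioo_mem_nhds ht.1 ht.2] with s hs
      rw [hĀA s hs.1.le hs.2]
    rw [hĀA t ht.1.le ht.2, ← hApde t ht.1 ht.2 x v]
    exact hev.deriv_eq
  -- restart at `Ā T` by short-time existence, and concatenate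
  have hĀT : IsSmoothConnection (Ā T) :=
    contDiff_slice_of_contDiffOn_prod hĀs ⟨hT.le, le_rfl⟩
  obtain ⟨ε, hε, B, hB0, hBs, hBp, hBv, hBpde⟩ :=
    hST N L hL (Ā T) hĀT (hĀval T hT le_rfl) (hĀper T hT.le le_rfl)
  obtain ⟨hCs, hCpde⟩ := restart_of_pde hT hε hĀs hĀpde hBs
    (fun t ht x v => hBpde t ht.1 ht.2 x v) hB0
  have PC : P (T + ε, fun t => if t ≤ T then Ā t else B (t - T)) := by
    refine ⟨by positivity, ?_, hCs, ?_, ?_, fun t ht0 ht x v => hCpde t ⟨ht0, ht⟩ x v⟩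
    · show (if (0 : ℝ) ≤ T then Ā 0 else B (0 - T)) = A₀
      rw [if_pos hT.le, hĀA 0 le_rfl hT]
      exact hA0
    · intro t ht0 ht
      show (if t ≤ T then Ā t else B (t - T)).IsLatticePeriodic L
      split_ifs with h
      · exact hĀper t ht0 h
      · exact hBp (t - T) (by linarith) (by linarith)
    · intro t ht0 ht
      show (if t ≤ T then Ā t else B (t - T)).IsValuedIn 𝔤
      split_ifs with h
      · exact hĀval t ht0 h
      · exact hBv (t - T) (by linarith) (by linarith)
  have hrC : r ⟨(T, A), hT, hA0, hAs, hAp, hAv, hApde⟩ ⟨_, PC⟩ := by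
    refine ⟨by dsimp only; linarith, fun t ht => ?_⟩
    show (if t ≤ T then Ā t else B (t - T)) = A t
    rw [if_pos ht.2.le, hĀA t ht.1 ht.2]
  have := (hm ⟨_, PC⟩ hrC).1
  dsimp only at this
  linarith

end Torus

end Literature.MathematicalPhysics.QuantumLattice
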